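import Literature.MathematicalPhysics.QuantumLattice.MPSCoarseGrainingMaps
import Literature.MathematicalPhysics.QuantumLattice.TraceInequalities
import Literature.LinearAlgebra.Matrix.HermitianCfcDiagonalForm
import HarnessLib

/-!
# A-priori bounds on the coarse-grained window variables of the MPS relaxation

Kull–Schuch–Dive–Navascués (KSDN, arXiv:2212.03014) §2.3–2.5 compress the `(k+2)`-site window marginal `ρ` of a
translation-invariant state to `ω = C_k(ρ) = (𝟙 ⊗ W_k ⊗ 𝟙) ρ̃ (𝟙 ⊗ W_k ⊗ 𝟙)ᴴ` (`MPSCoarseGrainingMaps`: `cgState`, `cgMap`).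
A certificate format that bounds its variables a priori (sr-mbsolver `FORMAT-ltisdp.md` §2 (c)) needs, for the TRUE marginals,
`|ω_{ij}| ≤ tr ω ≤ λ_max(W_kᴴ W_k) ≤ ‖W_k W_kᴴ‖_F`. This file proves that chain from first principles:

* `frobSq M = Σ_{ij} |M_{ij}|²` (the squared Frobenius norm as a plain sum) and `frobSq (Wᴴ W) = frobSq (W Wᴴ)`;
* the Rayleigh-quotient bound `|v† Y v| ≤ √(frobSq Y) · ‖v‖²` (two Cauchy–Schwarz steps) and hence the Löwner bound
  `Y ≤ √(frobSq Y) · 𝟙` for Hermitian `Y`;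
* `Re tr C_k(ρ) ≤ √(frobSq (W_k W_kᴴ))` and `|C_k(ρ)_{ij}| ≤ √(frobSq (W_k W_kᴴ))` for every density matrix `ρ`
  (`ρ ⪰ 0`, `tr ρ = 1`);
* the `λ_max` form used by trace-bounded certificate formats (sr-mbsolver D6 lane, FORMAT-ksdn v0.5 rule `lmax_psd`): from a
  Löwner bound `W_kᴴ W_k ≤ r·𝟙` (`0 ≤ r`), `Re tr C_k(ρ) ≤ r` and `|C_k(ρ)_{ij}| ≤ r` (`re_trace_cgState_le_of_loewner`,
  `norm_cgState_apply_le_of_loewner`; appended 2026-08-23 by sr-mbsolver lit-1 g15, same proof with the hypothesis in place of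
  the Frobenius Löwner bound), and the transfer `W Wᴴ ≤ r·𝟙 ⟹ Wᴴ W ≤ r·𝟙` (`r > 0`) from the small (`D² × D²`, certified) side to the
  big side (`conjTranspose_mul_self_le_smul_one_of_mul_conjTranspose_le`).

(`W_k W_kᴴ = Σ_t vec(P_t) vec(P_t)ᴴ`, `P_t = A^{t₁}⋯A^{t_k}`, is a realignment of the `k`-th power of the transfer matrix, so
`√(frobSq (W_k W_kᴴ)) = ‖T^k‖_F` — the constant `B_{k+2}` of the format; that identification is not needed for the bound and is
left to the instance.) No `sorry`, no new axiom, no named fact.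
[cite: KullEtAl2024, §2.3–2.5] [cite: HornJohnson2013, Theorem 5.1.4 (Cauchy–Schwarz); §7.1 Problem 7.1.P1; §7.7]
-/

noncomputable section

namespace Literature.MathematicalPhysics.QuantumLattice

open Matrix Finset Literature.Computability.QuantumComplexity Literature.LinearAlgebra.Matrix
open scoped ComplexOrder BigOperators Kronecker MatrixOrder

namespace MPSCoarseGraining

/-! ### §1 The squared Frobenius norm as a plain sum -/

section Frobenius

variable {m n : Type*} [Fintype m] [Fintype n]

/-- `‖M‖_F² = Σ_{i,j} |M_{ij}|²`. [cite: HornJohnson2013, §5.6 (the Frobenius norm `‖·‖₂`)] -/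
def frobSq (M : Matrix m n ℂ) : ℝ := ∑ i, ∑ j, ‖M i j‖ ^ 2

/-- `‖M‖_F² ≥ 0`. [cite: HornJohnson2013, §5.6] -/
theorem frobSq_nonneg (M : Matrix m n ℂ) : 0 ≤ frobSq M :=
  Finset.sum_nonneg fun _ _ => Finset.sum_nonneg fun _ _ => by positivity

/-- `‖M‖_F² = Re tr(Mᴴ M)`. [cite: HornJohnson2013, §5.6] -/
theorem frobSq_eq_re_trace (M : Matrix m n ℂ) : frobSq M = ((Mᴴ * M).trace).re := by
  rw [frobSq, Finset.sum_comm, Matrix.trace, Complex.re_sum]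
  refine Finset.sum_congr rfl fun j _ => ?_
  rw [Matrix.diag_apply, Matrix.mul_apply, Complex.re_sum]
  refine Finset.sum_congr rfl fun i _ => ?_
  rw [Matrix.conjTranspose_apply, RCLike.star_def, Complex.conj_mul', ← Complex.ofReal_pow, Complex.ofReal_re]

/-- **`‖WᴴW‖_F = ‖WWᴴ‖_F`** (both are `(tr (WᴴW)²)^{1/2}`). [cite: HornJohnson2013, §5.6] -/
theorem frobSq_conjTranspose_mul_self (W : Matrix m n ℂ) : frobSq (Wᴴ * W) = frobSq (W * Wᴴ) := by
  rw [frobSq_eq_re_trace, frobSq_eq_re_trace, Matrix.conjTranspose_mul, Matrix.conjTranspose_conjTranspose,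
    Matrix.conjTranspose_mul, Matrix.conjTranspose_conjTranspose, Matrix.mul_assoc, Matrix.trace_mul_comm]
  simp only [Matrix.mul_assoc]

omit [Fintype m] in
/-- Cauchy–Schwarz for one row: `|(Y v)_i|² ≤ (Σ_j |Y_{ij}|²)(Σ_j |v_j|²)`. [cite: HornJohnson2013, Theorem 5.1.4] -/
theorem norm_mulVec_apply_sq_le (Y : Matrix m n ℂ) (v : n → ℂ) (i : m) :
    ‖(Y *ᵥ v) i‖ ^ 2 ≤ (∑ j, ‖Y i j‖ ^ 2) * ∑ j, ‖v j‖ ^ 2 := by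
  have h1 : ‖(Y *ᵥ v) i‖ ≤ ∑ j, ‖Y i j‖ * ‖v j‖ := by
    rw [Matrix.mulVec, dotProduct]
    exact (norm_sum_le _ _).trans (Finset.sum_le_sum fun j _ => (norm_mul_le _ _))
  have h2 : (∑ j, ‖Y i j‖ * ‖v j‖) ^ 2 ≤ (∑ j, ‖Y i j‖ ^ 2) * ∑ j, ‖v j‖ ^ 2 :=
    Finset.sum_mul_sq_le_sq_mul_sq _ _ _
  exact (pow_le_pow_left₀ (norm_nonneg _) h1 2).trans h2

/-- `‖Y v‖² ≤ ‖Y‖_F² ‖v‖²`. [cite: HornJohnson2013, Theorem 5.1.4, §5.6] -/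
theorem sum_norm_mulVec_sq_le (Y : Matrix m n ℂ) (v : n → ℂ) :
    ∑ i, ‖(Y *ᵥ v) i‖ ^ 2 ≤ frobSq Y * ∑ j, ‖v j‖ ^ 2 := by
  rw [frobSq, Finset.sum_mul]
  exact Finset.sum_le_sum fun i _ => norm_mulVec_apply_sq_le Y v i

/-- **The Rayleigh quotient is bounded by the Frobenius norm**: `|v† Y v| ≤ √(‖Y‖_F²) · ‖v‖²`.
[cite: HornJohnson2013, Theorem 5.1.4; §5.6 (spectral radius ≤ any matrix norm)] -/
theorem norm_star_dotProduct_mulVec_le (Y : Matrix n n ℂ) (v : n → ℂ) :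
    ‖star v ⬝ᵥ (Y *ᵥ v)‖ ≤ Real.sqrt (frobSq Y) * ∑ j, ‖v j‖ ^ 2 := by
  have hv : 0 ≤ ∑ j, ‖v j‖ ^ 2 := Finset.sum_nonneg fun _ _ => by positivity
  -- first Cauchy–Schwarz: `|Σ_i conj(v_i) (Yv)_i| ≤ (Σ|v_i|²)^{1/2} (Σ |(Yv)_i|²)^{1/2}`
  have h1 : ‖star v ⬝ᵥ (Y *ᵥ v)‖ ≤ ∑ i, ‖v i‖ * ‖(Y *ᵥ v) i‖ := by
    rw [dotProduct]
    refine (norm_sum_le _ _).trans (Finset.sum_le_sum fun i _ => ?_)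
    rw [Pi.star_apply, norm_mul, norm_star]
  have h2 : (∑ i, ‖v i‖ * ‖(Y *ᵥ v) i‖) ^ 2 ≤ (∑ i, ‖v i‖ ^ 2) * ∑ i, ‖(Y *ᵥ v) i‖ ^ 2 :=
    Finset.sum_mul_sq_le_sq_mul_sq _ _ _
  have h3 : (∑ i, ‖v i‖ * ‖(Y *ᵥ v) i‖) ^ 2 ≤ (Real.sqrt (frobSq Y) * ∑ j, ‖v j‖ ^ 2) ^ 2 := by
    refine h2.trans ?_
    rw [mul_pow, Real.sq_sqrt (frobSq_nonneg Y), pow_two (∑ j, ‖v j‖ ^ 2), ← mul_assoc, mul_comm (frobSq Y)]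
    rw [mul_assoc]
    exact mul_le_mul_of_nonneg_left (sum_norm_mulVec_sq_le Y v) hv
  have h4 : 0 ≤ Real.sqrt (frobSq Y) * ∑ j, ‖v j‖ ^ 2 := mul_nonneg (Real.sqrt_nonneg _) hv
  have hS : 0 ≤ ∑ i, ‖v i‖ * ‖(Y *ᵥ v) i‖ := Finset.sum_nonneg fun i _ => mul_nonneg (norm_nonneg _) (norm_nonneg _)
  exact h1.trans ((pow_le_pow_iff_left₀ hS h4 two_ne_zero).1 h3)


/-- `x† x = Σ_j |x_j|²` (as a complex number). [cite: HornJohnson2013, §5.1] -/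
theorem star_dotProduct_self_eq (x : n → ℂ) : star x ⬝ᵥ x = ((∑ j, ‖x j‖ ^ 2 : ℝ) : ℂ) := by
  rw [dotProduct, Complex.ofReal_sum]
  refine Finset.sum_congr rfl fun j _ => ?_
  rw [Pi.star_apply, RCLike.star_def, Complex.conj_mul', Complex.ofReal_pow]

/-- **Löwner bound by the Frobenius norm**: `Y ≤ √(‖Y‖_F²) · 𝟙` for Hermitian `Y` (i.e. `λ_max(Y) ≤ ‖Y‖_F`).
[cite: HornJohnson2013, §5.6 (the spectral radius is dominated by every matrix norm), Theorem 5.1.4] -/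
theorem le_sqrt_frobSq_smul_one [DecidableEq n] {Y : Matrix n n ℂ} (hY : Y.IsHermitian) :
    Y ≤ Real.sqrt (frobSq Y) • (1 : Matrix n n ℂ) := by
  have h1 : (Real.sqrt (frobSq Y) • (1 : Matrix n n ℂ)).IsHermitian := by
    rw [Matrix.IsHermitian, Matrix.conjTranspose_smul, star_trivial, Matrix.conjTranspose_one]
  rw [Matrix.le_iff, Matrix.posSemidef_iff_dotProduct_mulVec]
  refine ⟨h1.sub hY, fun x => ?_⟩
  have hq := norm_star_dotProduct_mulVec_le Y x
  -- the quadratic form of a Hermitian matrix is real (cf. `Literature.NumberTheory.Automorphic.SiegelFamily`)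
  have him : (star x ⬝ᵥ (Y *ᵥ x)).im = 0 := by
    refine Complex.conj_eq_iff_im.1 ?_
    conv_lhs => rw [← Complex.star_def, Matrix.star_dotProduct, star_star, Matrix.star_mulVec, ← Matrix.dotProduct_mulVec, hY.eq]
  rw [Matrix.sub_mulVec, dotProduct_sub, Matrix.smul_mulVec, Matrix.one_mulVec, dotProduct_smul, star_dotProduct_self_eq,
    Complex.le_def]
  refine ⟨?_, ?_⟩
  · rw [Complex.zero_re, Complex.sub_re, Complex.real_smul, ← Complex.ofReal_mul, Complex.ofReal_re]
    linarith [Complex.re_le_norm (star x ⬝ᵥ (Y *ᵥ x))]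
  · rw [Complex.zero_im, Complex.sub_im, Complex.real_smul, ← Complex.ofReal_mul, Complex.ofReal_im, him, sub_zero]

end Frobenius

/-! ### §2 The bounds on the coarse-grained window `C_k(ρ)` -/

section Bounds

/-- `(A₁ − A₂) ⊗ B = A₁ ⊗ B − A₂ ⊗ B`. [folklore] -/
private theorem sub_kronecker {l m n p : Type*} (A₁ A₂ : Matrix l m ℂ) (B : Matrix n p ℂ) :
    (A₁ - A₂) ⊗ₖ B = A₁ ⊗ₖ B - A₂ ⊗ₖ B := by
  ext ⟨i, i'⟩ ⟨j, j'⟩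
  simp [Matrix.kroneckerMap_apply, sub_mul]

/-- `A ⊗ (B₁ − B₂) = A ⊗ B₁ − A ⊗ B₂`. [folklore] -/
private theorem kronecker_sub {l m n p : Type*} (A : Matrix l m ℂ) (B₁ B₂ : Matrix n p ℂ) :
    A ⊗ₖ (B₁ - B₂) = A ⊗ₖ B₁ - A ⊗ₖ B₂ := by
  ext ⟨i, i'⟩ ⟨j, j'⟩
  simp [Matrix.kroneckerMap_apply, mul_sub]

variable {β : Type*} [Fintype β] [DecidableEq β] {q : ℕ}

/-- `tr C_k(ρ) = tr((𝟙 ⊗ W_kᴴ W_k ⊗ 𝟙) ρ̃)`. [cite: KullEtAl2024, §2.3–2.5] -/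
theorem trace_cgState_eq (A : Fin q → Matrix β β ℂ) (k : ℕ) (ρ : Op (Fin (k + 2)) q) :
    (cgState A k ρ).trace = (((1 : Matrix (Fin q) (Fin q) ℂ) ⊗ₖ (((cgMap A k)ᴴ * cgMap A k) ⊗ₖ (1 : Matrix (Fin q) (Fin q) ℂ))) *
      ρ.submatrix (windowSplit3 k q) (windowSplit3 k q)).trace := by
  rw [cgState, Matrix.trace_mul_cycle, Matrix.conjTranspose_kronecker, Matrix.conjTranspose_kronecker, Matrix.conjTranspose_one,
    ← Matrix.mul_kronecker_mul, ← Matrix.mul_kronecker_mul, Matrix.one_mul]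

/-- **`Re tr C_k(ρ) ≤ ‖W_k W_kᴴ‖_F` for a density matrix `ρ`** (`tr ω = tr(ρ̃ (𝟙⊗WᴴW⊗𝟙)) ≤ λ_max(WᴴW) ≤ ‖WᴴW‖_F = ‖WWᴴ‖_F`).
[cite: KullEtAl2024, §2.3–2.5] [cite: HornJohnson2013, Theorem 5.1.4, §5.6] -/
theorem re_trace_cgState_le (A : Fin q → Matrix β β ℂ) (k : ℕ) {ρ : Op (Fin (k + 2)) q} (hρ : ρ.PosSemidef) (htr : ρ.trace = 1) :
    ((cgState A k ρ).trace).re ≤ Real.sqrt (frobSq (cgMap A k * (cgMap A k)ᴴ)) := by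
  set W := cgMap A k with hW
  set c : ℝ := Real.sqrt (frobSq (W * Wᴴ)) with hc
  have hc0 : 0 ≤ c := Real.sqrt_nonneg _
  have hρ' : (ρ.submatrix (windowSplit3 k q) (windowSplit3 k q)).PosSemidef := hρ.submatrix _
  have htr' : (ρ.submatrix (windowSplit3 k q) (windowSplit3 k q)).trace = 1 := by
    rw [← htr, Matrix.trace, Matrix.trace]
    exact (windowSplit3 k q).sum_comp (fun i => ρ i i)
  -- the middle factor is dominated by `c • 𝟙`
  have hY : (Wᴴ * W).IsHermitian := Matrix.isHermitian_conjTranspose_mul_self W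
  have hYle : Wᴴ * W ≤ c • (1 : Matrix (Fin k → Fin q) (Fin k → Fin q) ℂ) := by
    rw [hc, ← frobSq_conjTranspose_mul_self]
    exact le_sqrt_frobSq_smul_one hY
  have hup : (1 : Matrix (Fin q) (Fin q) ℂ) ⊗ₖ ((Wᴴ * W) ⊗ₖ (1 : Matrix (Fin q) (Fin q) ℂ)) ≤
      c • (1 : Matrix (Fin q × ((Fin k → Fin q) × Fin q)) (Fin q × ((Fin k → Fin q) × Fin q)) ℂ) := by
    rw [Matrix.le_iff] at hYle ⊢
    have h : c • (1 : Matrix (Fin q × ((Fin k → Fin q) × Fin q)) (Fin q × ((Fin k → Fin q) × Fin q)) ℂ) -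
        (1 : Matrix (Fin q) (Fin q) ℂ) ⊗ₖ ((Wᴴ * W) ⊗ₖ (1 : Matrix (Fin q) (Fin q) ℂ)) =
        (1 : Matrix (Fin q) (Fin q) ℂ) ⊗ₖ ((c • (1 : Matrix (Fin k → Fin q) (Fin k → Fin q) ℂ) - Wᴴ * W) ⊗ₖ
          (1 : Matrix (Fin q) (Fin q) ℂ)) := by
      rw [sub_kronecker, kronecker_sub, Matrix.smul_kronecker, Matrix.kronecker_smul, Matrix.one_kronecker_one,
        Matrix.one_kronecker_one]
    rw [h]
    exact Matrix.PosSemidef.one.kronecker (hYle.kronecker Matrix.PosSemidef.one)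
  have hlo : -(c • (1 : Matrix (Fin q × ((Fin k → Fin q) × Fin q)) (Fin q × ((Fin k → Fin q) × Fin q)) ℂ)) ≤
      (1 : Matrix (Fin q) (Fin q) ℂ) ⊗ₖ ((Wᴴ * W) ⊗ₖ (1 : Matrix (Fin q) (Fin q) ℂ)) := by
    rw [Matrix.le_iff, sub_neg_eq_add]
    refine (Matrix.PosSemidef.one.kronecker ((Matrix.posSemidef_conjTranspose_mul_self W).kronecker Matrix.PosSemidef.one)).add ?_
    rw [RCLike.real_smul_eq_coe_smul (K := ℂ)]
    exact Matrix.PosSemidef.one.smul (Complex.zero_le_real.2 hc0)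
  have key := norm_trace_mul_le_of_loewner hlo hup hρ'
  rw [← trace_cgState_eq, htr', RCLike.one_re, mul_one] at key
  exact (Complex.re_le_norm _).trans key

/-- **The a-priori bound on the coarse-grained variables**: `|C_k(ρ)_{ij}| ≤ ‖W_k W_kᴴ‖_F` for every density matrix
`ρ` — the constant `B_{k+2}` of a bounded-variable certificate format, since `W_k W_kᴴ` is a realignment of the `k`-th power
of the transfer matrix. [cite: KullEtAl2024, §2.3–2.5] [cite: HornJohnson2013, §7.1 Problem 7.1.P1] -/
theorem norm_cgState_apply_le (A : Fin q → Matrix β β ℂ) (k : ℕ) {ρ : Op (Fin (k + 2)) q} (hρ : ρ.PosSemidef)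
    (htr : ρ.trace = 1) (i j : Fin q × ((β × β) × Fin q)) :
    ‖cgState A k ρ i j‖ ≤ Real.sqrt (frobSq (cgMap A k * (cgMap A k)ᴴ)) := by
  have h := norm_apply_le_re_trace_of_posSemidef (posSemidef_cgState A k hρ) i j
  rw [RCLike.re_to_complex] at h
  exact h.trans (re_trace_cgState_le A k hρ htr)

/-- Instance form: any `B` with `‖W_k W_kᴴ‖_F² ≤ B²`, `0 ≤ B`, bounds the variables. [cite: KullEtAl2024, §2.3–2.5] -/
theorem norm_cgState_apply_le_of_frobSq_le (A : Fin q → Matrix β β ℂ) (k : ℕ) {ρ : Op (Fin (k + 2)) q} (hρ : ρ.PosSemidef)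
    (htr : ρ.trace = 1) {B : ℝ} (hB0 : 0 ≤ B) (hB : frobSq (cgMap A k * (cgMap A k)ᴴ) ≤ B ^ 2)
    (i j : Fin q × ((β × β) × Fin q)) : ‖cgState A k ρ i j‖ ≤ B :=
  (norm_cgState_apply_le A k hρ htr i j).trans ((Real.sqrt_le_sqrt hB).trans_eq (Real.sqrt_sq hB0))

/-- **`Re tr C_k(ρ) ≤ r` from a Loewner bound `W_kᴴ W_k ≤ r·𝟙`** — the `λ_max` form of the trace bound (the `lmax_psd` bound rule of the
D6 lane's FORMAT-ksdn v0.5: a reader re-certifies `r·𝟙 − W_kᴴ W_k ⪰ 0` exactly, and then `tr ω = tr(ρ̃ (𝟙 ⊗ W_kᴴW_k ⊗ 𝟙)) ≤ r·tr ρ̃ = r`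
for every density matrix `ρ`); the Frobenius form `re_trace_cgState_le` is the case `r = ‖W_kᴴW_k‖_F`. Same proof, with the Loewner
hypothesis in place of `le_sqrt_frobSq_smul_one`. [cite: KullEtAl2024, §2.3–2.5] [cite: HornJohnson2013, §7.7] -/
theorem re_trace_cgState_le_of_loewner (A : Fin q → Matrix β β ℂ) (k : ℕ) {ρ : Op (Fin (k + 2)) q} (hρ : ρ.PosSemidef)
    (htr : ρ.trace = 1) {r : ℝ} (hr0 : 0 ≤ r)
    (hr : (cgMap A k)ᴴ * cgMap A k ≤ r • (1 : Matrix (Fin k → Fin q) (Fin k → Fin q) ℂ)) :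
    ((cgState A k ρ).trace).re ≤ r := by
  set W := cgMap A k with hW
  have hρ' : (ρ.submatrix (windowSplit3 k q) (windowSplit3 k q)).PosSemidef := hρ.submatrix _
  have htr' : (ρ.submatrix (windowSplit3 k q) (windowSplit3 k q)).trace = 1 := by
    rw [← htr, Matrix.trace, Matrix.trace]
    exact (windowSplit3 k q).sum_comp (fun i => ρ i i)
  have hup : (1 : Matrix (Fin q) (Fin q) ℂ) ⊗ₖ ((Wᴴ * W) ⊗ₖ (1 : Matrix (Fin q) (Fin q) ℂ)) ≤
      r • (1 : Matrix (Fin q × ((Fin k → Fin q) × Fin q)) (Fin q × ((Fin k → Fin q) × Fin q)) ℂ) := by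
    have hYle := hr
    rw [Matrix.le_iff] at hYle ⊢
    have h : r • (1 : Matrix (Fin q × ((Fin k → Fin q) × Fin q)) (Fin q × ((Fin k → Fin q) × Fin q)) ℂ) -
        (1 : Matrix (Fin q) (Fin q) ℂ) ⊗ₖ ((Wᴴ * W) ⊗ₖ (1 : Matrix (Fin q) (Fin q) ℂ)) =
        (1 : Matrix (Fin q) (Fin q) ℂ) ⊗ₖ ((r • (1 : Matrix (Fin k → Fin q) (Fin k → Fin q) ℂ) - Wᴴ * W) ⊗ₖ
          (1 : Matrix (Fin q) (Fin q) ℂ)) := by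
      rw [sub_kronecker, kronecker_sub, Matrix.smul_kronecker, Matrix.kronecker_smul, Matrix.one_kronecker_one,
        Matrix.one_kronecker_one]
    rw [h]
    exact Matrix.PosSemidef.one.kronecker (hYle.kronecker Matrix.PosSemidef.one)
  have hlo : -(r • (1 : Matrix (Fin q × ((Fin k → Fin q) × Fin q)) (Fin q × ((Fin k → Fin q) × Fin q)) ℂ)) ≤
      (1 : Matrix (Fin q) (Fin q) ℂ) ⊗ₖ ((Wᴴ * W) ⊗ₖ (1 : Matrix (Fin q) (Fin q) ℂ)) := by
    rw [Matrix.le_iff, sub_neg_eq_add]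
    refine (Matrix.PosSemidef.one.kronecker ((Matrix.posSemidef_conjTranspose_mul_self W).kronecker Matrix.PosSemidef.one)).add ?_
    rw [RCLike.real_smul_eq_coe_smul (K := ℂ)]
    exact Matrix.PosSemidef.one.smul (Complex.zero_le_real.2 hr0)
  have key := norm_trace_mul_le_of_loewner hlo hup hρ'
  rw [← trace_cgState_eq, htr', RCLike.one_re, mul_one] at key
  exact (Complex.re_le_norm _).trans key

/-- Instance form of the `λ_max` rule for the VARIABLES: `W_kᴴ W_k ≤ r·𝟙`, `0 ≤ r` ⟹ `|C_k(ρ)_{ij}| ≤ r` for every density matrix `ρ`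
(`|ω_{ij}| ≤ Re tr ω` for `ω ⪰ 0`). [cite: KullEtAl2024, §2.3–2.5] [cite: HornJohnson2013, §7.1 Problem 7.1.P1] -/
theorem norm_cgState_apply_le_of_loewner (A : Fin q → Matrix β β ℂ) (k : ℕ) {ρ : Op (Fin (k + 2)) q} (hρ : ρ.PosSemidef)
    (htr : ρ.trace = 1) {r : ℝ} (hr0 : 0 ≤ r)
    (hr : (cgMap A k)ᴴ * cgMap A k ≤ r • (1 : Matrix (Fin k → Fin q) (Fin k → Fin q) ℂ))
    (i j : Fin q × ((β × β) × Fin q)) : ‖cgState A k ρ i j‖ ≤ r := by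
  have h := norm_apply_le_re_trace_of_posSemidef (posSemidef_cgState A k hρ) i j
  rw [RCLike.re_to_complex] at h
  exact h.trans (re_trace_cgState_le_of_loewner A k hρ htr hr0 hr)

/-- **`W Wᴴ ≤ r·𝟙 ⟹ Wᴴ W ≤ r·𝟙`** (`r > 0`; both say `‖W‖²_op ≤ r`). This moves a `λ_max` certificate stated on the SMALL Gram matrix
`W_k W_kᴴ` (`D² × D²`, the realigned transfer-matrix power that the D6 lane's readers certify, FORMAT-ksdn v0.5 rule `lmax_psd`) to the BIG side
`W_kᴴ W_k` used by `re_trace_cgState_le_of_loewner`. Algebraic proof: with `Y = WᴴW`, `M = r·𝟙 − Y`, one has `r·M = MᴴM + Wᴴ(r·𝟙 − WWᴴ)W ⪰ 0`.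
[cite: HornJohnson2013, §7.7] -/
theorem conjTranspose_mul_self_le_smul_one_of_mul_conjTranspose_le {m n : Type*} [Fintype m] [Fintype n] [DecidableEq m] [DecidableEq n]
    (W : Matrix m n ℂ) {r : ℝ} (hr0 : 0 < r) (hr : W * Wᴴ ≤ r • (1 : Matrix m m ℂ)) : Wᴴ * W ≤ r • (1 : Matrix n n ℂ) := by
  rw [Matrix.le_iff] at hr ⊢
  set P : Matrix m m ℂ := r • (1 : Matrix m m ℂ) - W * Wᴴ with hP
  set M : Matrix n n ℂ := r • (1 : Matrix n n ℂ) - Wᴴ * W with hM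
  have hMh : Mᴴ = M := by
    rw [hM, Matrix.conjTranspose_sub, Matrix.conjTranspose_smul, Matrix.conjTranspose_one, Matrix.conjTranspose_mul,
      Matrix.conjTranspose_conjTranspose, RCLike.star_def, RCLike.conj_to_real]
  have h1 : (Wᴴ * P * W).PosSemidef := by
    simpa only [Matrix.conjTranspose_conjTranspose] using hr.conjTranspose_mul_mul_same W
  have h2 : (Mᴴ * M).PosSemidef := Matrix.posSemidef_conjTranspose_mul_self M
  have key : ((r : ℂ)) • M = Mᴴ * M + Wᴴ * P * W := by
    rw [hMh, hM, hP]
    simp only [RCLike.real_smul_eq_coe_smul (K := ℂ), Matrix.mul_sub, Matrix.sub_mul, Matrix.mul_smul, Matrix.smul_mul,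
      Matrix.mul_one, Matrix.one_mul, smul_sub, smul_smul, Matrix.mul_assoc]
    abel
  have hsum : (((r : ℂ)) • M).PosSemidef := by
    rw [key]
    exact h2.add h1
  have hinv : M = ((r⁻¹ : ℝ) : ℂ) • (((r : ℂ)) • M) := by
    rw [smul_smul, ← Complex.ofReal_mul, inv_mul_cancel₀ hr0.ne', Complex.ofReal_one, one_smul]
  rw [hinv]
  exact hsum.smul (Complex.zero_le_real.2 (inv_nonneg.2 hr0.le))

end Bounds

end MPSCoarseGraining

end Literature.MathematicalPhysics.QuantumLattice
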